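/-
Copyright (c) 2026 the pub-hodgecm-mathlib formalisation cell (harness21).  Prover seat hodgecm-mathlib-LH4-p16 (g2), req620 Track A «(D-RAM) FOUR-FRAME» squad
(STAGE-1b, row (2) of the piece `f_{T₊}`, the (β₂) road (R-36); β₂ sub-dealer LH4-p04 (g9) (L-Σ-3C), lane-C hinge LH7-p10 (g2); the lane-C row letters composed for the
assembler: ★ p862581 + ★ p862706 + ★ `hk_of_lt`), 2026-09-04.
-/
import Summits.HodgeConjecture.HodgeConjecture.Theorems.F0P3cDyRamNearCellFlippedLetter       -- ★ p862581 (this seat): HEAD `…eq_twist_smul_xPlus_of_flip`, HEAD′ `…eq_smul_xPlus_of_clean`; brings ★ p862234 `hk_of_lt`, ★ glue letters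
import Summits.HodgeConjecture.HodgeConjecture.Theorems.F0P3cDyRamRayLettersTokensRamM         -- ★ p862706 (this seat): `exists_isOrd_of_coords`, `v_boundaryDigit_eq_flip`, `v_boundary_max_le_of_pairing`
import HarnessLib

/-!
# Crux `H413`, line LH4 «(D-RAM) FOUR-FRAME» — STAGE-1b, row (2), the (β₂) road (R-36), lane C: «THE ROW-VERTEX LETTERS FROM THE TOKENS» — ★ p862581's CLEAN and FLIP letters
# with their four regime binders (`hμ hμt hmm`, `hk`, `hflip`∕`hclean`) DISCHARGED from the cell's tokens at the conductor `cc = jEϖ^j`: the consumer supplies only ★ HEAD B's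
# frame, the level `|Y| = |jEϖ|^b`, the sizes `|μ_a| = |ϖ|^{2b+d%2}`, `|jE μ_b| = |jEϖ|^{jl}`, the clean `E`-letter of ★ p862630, and ONE inequality in `(j, b, jl)`

Cell `hodgecm-mathlib` (D-0151), FLOOR 0, crux item H413 = `stmt-HodgeConjecture-24833`, route of record `HCCMUnconditional`; squad F0∕P3c∕LH4; lane
`--supports stmt-HodgeConjecture-24833 --as helper` (count-neutral; pays NO tier-0 row).  THEOREMS ONLY (no `def`, no instance, no notation, no `sorry`, default heartbeats);
★-only imports; states NO law; (β₂) stays a HYPOTHESIS.  Same datum-light frame as ★ p862581 (★ p861372 HEAD B + the sheet datum on `E`), specialised to `cc := jEϖ^j`.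

WHY (MECH-K1 v1 `F0/P3c/LH4/LH4-p16/g2/MECH-K1.v1.LH4p16g2.md` §2–§3; LH7-p10 (g2)'s lane-C cone letter `beta2ConesC` wants the row cells BY NAME).  On the row `a = b` the cell
`(j, b)` with `k′ := j − b`, `δ′ := jl − 2b`: CLEAN for `j + b + m* ≤ jl` — ANY `j ≥ b`, the DIAGONAL cell included, no `hk` needed (★ p862706 `v_boundary_max_le_of_pairing`: on `D`
`hk` fails with equality and the max-form letter is still sharp — MECH-K1 §3 «the D cell needs no factorisation»); FLIP at `jl + 1 = j + b + m*` for `j > b` (★ `hk_of_lt` +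
★ p862706 `v_boundaryDigit_eq_flip`).  So at `K₀`'s flip digit `jl = 2b + s0 + m* − 1`: `D = (b + s0 − 1, b)` is CLEAN (`e • X₊`) and `K₀ = (b + s0, b)` FLIPS (`(c·e) • X₊`) with the
SAME `e = f·h_W·N(ϖ^b g₀1)` — (κ-b) «`K₀ = −D`» per vertex, from tokens.
* `valueSet_rowVertex_eq_smul_xPlus_of_tokens` — CLEAN: `b ≤ j`, `j + b + m* ≤ jl` ⟹ `VS_{m*} = valueSetMod σ ϖ m* (e • X₊)`.
* `valueSet_rowVertex_eq_twist_smul_xPlus_of_tokens` — FLIP (`q = 2`): `b < j`, `jl = j + b + 2(d−1) + d%2` ⟹ `VS_{m*} = valueSetMod σ ϖ m* ((c·e) • X₊)` for every fixed non-norm unit `c`.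
Remaining binders beyond ★ HEAD B's frame: `hYO`, `hYv` (the cell's integrality and level clauses), `hμab` (the `jE(E)`-coordinates, ★ p862572 §1), `hμav`, `hμbv` (tokens),
`hσf hf1 hμa hn` (★ p862630's `E`-letter, `n := jl + g + 1 − d`), `hdb : d ≤ b` (the row is deeper than the datum).
HONEST LABEL.  Count-neutral composition; nothing printed is asserted; no census law is stated; `HC_CM` is proved only modulo the 7 printed citations (2 remaining named inputs:
hLiu418 = `stmt-HodgeConjecture-24832`, h413 = `stmt-HodgeConjecture-24833`) until rung 0 closes.
## References
* [Serre1979] J.-P. Serre, *Local Fields*, GTM 67 (1979): Ch. III §6 Prop. 12, Ch. V §3 Prop. 5, Cor. 2–3; [Jacobowitz1962] R. Jacobowitz, Amer. J. Math. 84 (1962): §4.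
* [Rogawski1990] J. D. Rogawski, Ann. of Math. Stud. 123 (1990): §4.9 Prop. 4.9.1 (b) p. 55; [Kottwitz1986BaseChangeUnits] R. E. Kottwitz, Compositio Math. 60 (1986): §1 pp. 240–241.
-/

set_option autoImplicit false

noncomputable section

namespace Summit.HodgeConjecture.HodgeConjecture.Cruxes.H413.F0P3cDyRamRowVertexLettersOfTokens

open scoped Valued WithZero Matrix MatrixGroups
open WithZero
open Literature.NumberTheory.Automorphic Literature.NumberTheory.Automorphic.HermitianLattice Literature.NumberTheory.Automorphic.UnitaryLatticeTree
open Literature.NumberTheory.Automorphic.UnitaryThreeFourFrame (IsRamifiedQuadraticDatum)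
open Literature.NumberTheory.Rogawski1990
open Summit.HodgeConjecture.HodgeConjecture.Cruxes.H413.F0P3cDyRamFourFramePieces
open Summit.HodgeConjecture.HodgeConjecture.Cruxes.H413.F0P3cDyRamToricCensusDefs
open Summit.HodgeConjecture.HodgeConjecture.Cruxes.H413.F0P3cDyRamRayScalarBoundaryTerm (hk_of_lt v_mul_pow_le_one_of_int v_map_mul_pow_le_one)
open Summit.HodgeConjecture.HodgeConjecture.Cruxes.H413.F0P3cDyRamDiagonalCellLetter (inv_add_map_inv_eq_map_pairing)
open Summit.HodgeConjecture.HodgeConjecture.Cruxes.H413.F0P3cDyRamBlockGlueLabelFibreConstant (pairing_self_eq_plane_add_line)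
open Summit.HodgeConjecture.HodgeConjecture.Cruxes.H413.F0P3cDyRamDiagonalCellCleanRegime (v_map_le_pow_iff v_eq_pow_of_map_eq)
open Summit.HodgeConjecture.HodgeConjecture.Cruxes.H413.F0P3cDyRamNearCellFlippedLetter (valueSet_endoGL_sub_one_glued_eq_smul_xPlus_of_clean
  valueSet_endoGL_sub_one_glued_eq_twist_smul_xPlus_of_flip)
open Summit.HodgeConjecture.HodgeConjecture.Cruxes.H413.F0P3cDyRamRayLettersTokensRamM (exists_isOrd_of_coords v_boundaryDigit_eq_flip v_boundary_max_le_of_pairing)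

variable {E M : Type} [Field E] [Valued E ℤᵐ⁰] [Field M] [Valued M ℤᵐ⁰] {ρ Θ : M →+* M} {α : M}

/-! ## §1 The conductor `cc = jEϖ^j`: its order letters, and the glue bound `|jE pw|·|jEϖ|^{2b} ≤ 1` of an integral glued vertex -/

omit [Valued E ℤᵐ⁰] in
/-- The conductor `jEϖ^j` is `ρ`-fixed, non-zero, integral, and `jEϖ^j·(α − ρα) ≠ 0` — the four order letters of ★ p862581 at `cc := jEϖ^j`. [cite: Serre1979, Ch. III §6 Prop. 12] -/
theorem conductor_letters (jE : E →+* M) (hjfix : ∀ z, ρ z = z ↔ ∃ c, jE c = z) (hα : ρ α ≠ α) {ϖ : E} (hϖ0 : ϖ ≠ 0) (hπ1 : Valued.v (jE ϖ) ≤ 1) (j : ℕ) :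
    ρ (jE ϖ ^ j) = jE ϖ ^ j ∧ jE ϖ ^ j ≠ 0 ∧ Valued.v (jE ϖ ^ j) ≤ 1 ∧ jE ϖ ^ j * (α - ρ α) ≠ 0 := by
  have hπ0 : jE ϖ ≠ 0 := (map_ne_zero jE).2 hϖ0
  refine ⟨by rw [← map_pow]; exact (hjfix _).2 ⟨ϖ ^ j, rfl⟩, pow_ne_zero _ hπ0, by rw [Valuation.map_pow]; exact pow_le_one₀ zero_le hπ1,
    mul_ne_zero (pow_ne_zero _ hπ0) (sub_ne_zero.2 (Ne.symm hα))⟩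

omit [Valued E ℤᵐ⁰] [Field M] [Valued M ℤᵐ⁰] in
/-- The plane part of the glue generator: `g₀ − (g₀ 1)·e₁ = ι_W w₀` gives `(g₀ 0, g₀ 2) = w₀`. [cite: Jacobowitz1962, §4] -/
theorem vecTwo_eq_of_sub_single {g₀ : Fin 3 → E} {w₀ : Fin 2 → E} (hprg : g₀ - Pi.single 1 (g₀ 1) = ![w₀ 0, 0, w₀ 1]) :
    (![g₀ 0, g₀ 2] : Fin 2 → E) = w₀ := by
  have h0 := congrFun hprg 0
  have h2 := congrFun hprg 2
  simp only [Pi.sub_apply, Pi.single_apply] at h0 h2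
  ext i; fin_cases i <;> simp_all

/-! ## §2 CLEAN from the tokens: `b ≤ j`, `j + b + m* ≤ jl` (the diagonal cell included) -/

/-- **CLEAN ROW VERTEX FROM THE TOKENS.**  ★ p862581 HEAD′'s frame at `cc := jEϖ^j` with, in place of `hμ hμt hmm` and `hclean`: the level `|Y| = |jEϖ|^b`, the coordinates
`lam − jE u₀₀ = jE μ_a + jE μ_b·α` with `|μ_a| = |ϖ|^{2b+d%2}`, `|jE μ_b| = |jEϖ|^{jl}`, and `b ≤ j`, `j + b + m* ≤ jl`, `d ≤ b` ⟹ `VS_{m*} = valueSetMod σ ϖ m* (e • X₊)`,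
`e = f·h_W·N(ϖ^b g₀1)` — on EVERY such cell, the diagonal `j = b + s0 − 1` INCLUDED (no `hk`). [cite: Jacobowitz1962, §4] [cite: Rogawski1990, §4.9 Prop. 4.9.1 (b) p. 55]
[cite: Kottwitz1986BaseChangeUnits, §1 pp. 240–241] [cite: Serre1979, Ch. V §3 Cor. 3] -/
theorem valueSet_rowVertex_eq_smul_xPlus_of_tokens {σ : E →+* E} {ϖ : E} {d t : ℕ} (hD : IsRamifiedQuadraticDatum σ ϖ d t)
    (H₂ : Matrix (Fin 2) (Fin 2) E) {h : E} (hh1 : Valued.v h = 1)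
    (jE : E →+* M) (hjv : ∀ c, Valued.v (jE c) ≤ 1 ↔ Valued.v c ≤ 1) (hjfix : ∀ z, ρ z = z ↔ ∃ c, jE c = z)
    (hρρ : ∀ x, ρ (ρ x) = x) (hvρ : ∀ x, Valued.v (ρ x) = Valued.v x) (hα : ρ α ≠ α) (hα1 : Valued.v α ≤ 1)
    (hintρ : ∀ z : M, Valued.v z ≤ 1 → Valued.v ((z - ρ z) / (α - ρ α)) ≤ 1)
    (hΘΘ : ∀ x, Θ (Θ x) = x) (hΘρ : ∀ x, Θ (ρ x) = ρ (Θ x)) (hvΘ : ∀ x, Valued.v (Θ x) = Valued.v x) (hΘj : ∀ c, Θ (jE c) = jE (σ c))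
    (φ : (Fin 2 → E) →+ M) (hφs : ∀ (c : E) (x : Fin 2 → E), φ (c • x) = jE c * φ x)
    {γ₂ : GL (Fin 2) E} {lam hM : M} (hφγ : ∀ x, φ ((γ₂ : Matrix (Fin 2) (Fin 2) E) *ᵥ x) = lam * φ x) (hhM : hM ≠ 0) (hΘh : Θ hM = hM)
    (hform : ∀ x y, jE (pairing σ H₂ x y) = hM * Θ (φ x) * φ y + ρ (hM * Θ (φ x) * φ y))
    {L : Submodule 𝒪[E] (Fin 3 → E)} {b : ℕ} (hpr : ∀ x ∈ L, Valued.v (x 1) * Valued.v ϖ ^ b ≤ 1)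
    (hint : ∀ y ∈ L, Valued.v (pairing σ (!![H₂ 0 0, 0, H₂ 0 1; 0, h, 0; H₂ 1 0, 0, H₂ 1 1] : Matrix (Fin 3) (Fin 3) E) y y) ≤ 1)
    {B₂ : Submodule 𝒪[E] (Fin 2 → E)} {w₀ : Fin 2 → E} {g₀ : Fin 3 → E}
    (hB : B₂.map ((Matrix.toLin' (!![1, 0; 0, 0; 0, 1] : Matrix (Fin 3) (Fin 2) E)).restrictScalars 𝒪[E]) =
      L ⊓ LinearMap.ker ((LinearMap.proj (1 : Fin 3) : (Fin 3 → E) →ₗ[E] E).restrictScalars 𝒪[E]))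
    (hg₀ : g₀ ∈ L) (hg₀1 : Valued.v (g₀ 1) * Valued.v ϖ ^ b = 1) (hprg : g₀ - Pi.single 1 (g₀ 1) = ![w₀ 0, 0, w₀ 1])
    (u : GL (Fin 1) E) (hum : Valued.v ((u : Matrix (Fin 1) (Fin 1) E) 0 0 - 1) ≤ Valued.v (ϖ ^ mstarOfRecord d))
    {j : ℕ} {x₀ : M} (hx₀ : x₀ ≠ 0) {Λ : AddSubgroup M} (hBΛ : B₂.toAddSubgroup.map φ = Λ)
    (hΛx : ∀ x, x ∈ Λ ↔ ∃ ζ, IsOrd ρ α (jE ϖ ^ j) ζ ∧ x = x₀ * ζ) (hw₀Y : φ w₀ = (dualGen ρ Θ α (jE ϖ ^ j) hM x₀)⁻¹ * x₀)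
    -- the cell: integral member of level `b`
    (hYO : IsOrd ρ α (jE ϖ ^ j) (dualGen ρ Θ α (jE ϖ ^ j) hM x₀)) (hYv : Valued.v (dualGen ρ Θ α (jE ϖ ^ j) hM x₀) = Valued.v (jE ϖ) ^ b)
    -- the coordinates and tokens of the depth multiplier
    {μa μb : E} (hμab : lam - jE ((u : Matrix (Fin 1) (Fin 1) E) 0 0) = jE μa + jE μb * α)
    (hμav : Valued.v μa = Valued.v ϖ ^ (2 * b + d % 2)) {jl : ℕ} (hμbv : Valued.v (jE μb) = Valued.v (jE ϖ) ^ jl)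
    -- the clean `E`-letter (★ p862630)
    {f : E} (hf1 : Valued.v f = 1) {n : ℕ}
    (hμa : Valued.v (μa + f * ((ϖ - σ ϖ) * ((ϖ * σ ϖ) ^ ((d - d % 2) / 2))⁻¹) * (ϖ * σ ϖ) ^ b) ≤ Valued.v ϖ ^ n)
    (hn : 2 * b + mstarOfRecord d ≤ n) (hdb : d ≤ b)
    -- the CLEAN inequality of the cell
    (hbj : b ≤ j) (hjl : j + b + mstarOfRecord d ≤ jl) :
    {z : E | ∃ y ∈ L, Valued.v ((ϖ ^ mstarOfRecord d)⁻¹ * (z - pairing σ (!![H₂ 0 0, 0, H₂ 0 1; 0, h, 0; H₂ 1 0, 0, H₂ 1 1] : Matrix (Fin 3) (Fin 3) E) y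
        ((((endoGL (γ₂, u) : GL (Fin 3) E) : Matrix (Fin 3) (Fin 3) E) - 1) *ᵥ y))) ≤ 1} =
      valueSetMod σ ϖ (mstarOfRecord d) ((f * h * ((ϖ ^ b * g₀ 1) * σ (ϖ ^ b * g₀ 1))) • xPlus σ ϖ d) := by
  obtain ⟨hσσ, hvσ, hϖ, -, hd, hd1, -⟩ := id hD
  have hvϖ0 : Valued.v ϖ ≠ 0 := by rw [hϖ]; exact exp_ne_zero
  have hϖ0 : ϖ ≠ 0 := fun h0 => by rw [h0, map_zero] at hvϖ0; exact hvϖ0 rfl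
  have hϖ1 : Valued.v ϖ ≤ 1 := by rw [hϖ, ← exp_zero, exp_le_exp]; norm_num
  have hπ1 : Valued.v (jE ϖ) ≤ 1 := (hjv ϖ).2 hϖ1
  have hπ0 : Valued.v (jE ϖ) ≠ 0 := (Valuation.ne_zero_iff _).2 ((map_ne_zero jE).2 hϖ0)
  have hρj : ∀ c : E, ρ (jE c) = jE c := fun c => (hjfix _).2 ⟨c, rfl⟩
  have hα0 : α - ρ α ≠ 0 := sub_ne_zero.2 (Ne.symm hα)
  obtain ⟨hc, hc0, hc1, hcc⟩ := conductor_letters (ρ := ρ) jE hjfix hα hϖ0 hπ1 j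
  have hm : mstarOfRecord d = d % 2 + 2 * d - 1 := rfl
  -- (1) order-integrality at the modulus `m′ := m*` (★ p862706 §1)
  have hμaM : Valued.v (jE μa) ≤ Valued.v (jE ϖ) ^ mstarOfRecord d :=
    (v_map_le_pow_iff jE hjv hϖ0 μa _).2 (by rw [hμav]; exact pow_le_pow_right_of_le_one' hϖ1 (by rw [hm]; omega))
  have hμbM : Valued.v (jE μb) ≤ Valued.v (jE ϖ) ^ mstarOfRecord d := by
    rw [hμbv]; exact pow_le_pow_right_of_le_one' hπ1 (by omega)
  have hμbMj : Valued.v (jE μb) ≤ Valued.v (jE ϖ) ^ (mstarOfRecord d + j) := by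
    rw [hμbv]; exact pow_le_pow_right_of_le_one' hπ1 (by omega)
  obtain ⟨μt, hμ, hμt⟩ := exists_isOrd_of_coords (ρ := ρ) jE hρj hα1 hϖ0 hμab hμaM hμbM hμbMj
  -- (2) the glue letters of the vertex: `Tr_ρ D₀⁻¹ = jE pw`, `|jE pw|·|jEϖ|^{2b} ≤ 1`
  have hTr := inv_add_map_inv_eq_map_pairing σ H₂ jE hΘΘ φ hhM hform hcc hx₀ hw₀Y
  have hw₀g : (![g₀ 0, g₀ 2] : Fin 2 → E) = w₀ := vecTwo_eq_of_sub_single hprg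
  have hintg : Valued.v (pairing σ H₂ w₀ w₀ + σ (g₀ 1) * h * g₀ 1) ≤ 1 := by
    have h1 := hint g₀ hg₀
    rwa [pairing_self_eq_plane_add_line σ H₂ h g₀, hw₀g] at h1
  have hu₀ : Valued.v (ϖ ^ b * g₀ 1) = 1 := by rw [Valuation.map_mul, Valuation.map_pow, mul_comm]; exact hg₀1
  have hpw : Valued.v (jE (pairing σ H₂ w₀ w₀)) * Valued.v (jE ϖ) ^ (2 * b) ≤ 1 :=
    v_map_mul_pow_le_one jE hjv (v_mul_pow_le_one_of_int σ hvσ hϖ1 hintg hu₀ hh1.le)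
  -- (3) the CLEAN dictionary letter without `hk` (★ p862706 `v_boundary_max_le_of_pairing`)
  have hclean := v_boundary_max_le_of_pairing (ρ := ρ) hvΘ hα0 jE hπ0 hπ1 (cc := jE ϖ ^ j) (Y := dualGen ρ Θ α (jE ϖ ^ j) hM x₀) rfl
    (by rw [Valuation.map_pow]) hYv hμbv hjl (by omega : 2 * b + mstarOfRecord d ≤ jl) hTr hpw
  exact valueSet_endoGL_sub_one_glued_eq_smul_xPlus_of_clean hD H₂ hh1 jE hjv hjfix hρρ hvρ hα hα1 hintρ hΘΘ hΘρ hvΘ hΘj φ hφs hφγ hhM hΘh hform hpr hint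
    hB hg₀ hg₀1 hprg u hum hc hc0 hc1 hcc hx₀ hBΛ hΛx hw₀Y hYO hμ hμt le_rfl hμab hf1 hμa hn hdb hclean

/-! ## §3 FLIP from the tokens: `b < j`, `jl = j + b + 2(d−1) + d%2` (i.e. `jl + 1 = j + b + m*`), `q = 2` -/

/-- **FLIPPED ROW VERTEX FROM THE TOKENS** (`q = 2`).  ★ p862581 HEAD's frame at `cc := jEϖ^j` with, in place of `hμ hμt hmm`, `hk`, `hflip`: the level `|Y| = |jEϖ|^b`, the
coordinates with `|μ_a| = |ϖ|^{2b+d%2}`, `|jE μ_b| = |jEϖ|^{jl}`, and `b < j` (above the diagonal: `hk` by ★ `hk_of_lt`), `jl = j + b + 2(d−1) + d%2` (the FLIP DIGIT of the cell),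
`d ≤ b` ⟹ `VS_{m*} = valueSetMod σ ϖ m* ((c·e) • X₊)` for every `σ`-fixed non-norm unit `c` — `K₀ = (b + s0, b)` at `jl = 2b + s0 + m* − 1`, the tower cell `(b + k′, b)` at `jl = 2b + k′ + m* − 1`.
[cite: Serre1979, Ch. V §3 Prop. 5, Cor. 2–3] [cite: Jacobowitz1962, §4] [cite: Rogawski1990, §4.9 Prop. 4.9.1 (b) p. 55] [cite: Kottwitz1986BaseChangeUnits, §1 pp. 240–241] -/
theorem valueSet_rowVertex_eq_twist_smul_xPlus_of_tokens [CompleteSpace E] [Fintype 𝓀[E]]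
    {σ : E →+* E} {ϖ : E} {d t : ℕ} (hD : IsRamifiedQuadraticDatum σ ϖ d t) (h2v : Valued.v (2 : E) < 1) (hq : Fintype.card 𝓀[E] = 2)
    (H₂ : Matrix (Fin 2) (Fin 2) E) {h : E} (hσh : σ h = h) (hh1 : Valued.v h = 1)
    (jE : E →+* M) (hjv : ∀ c, Valued.v (jE c) ≤ 1 ↔ Valued.v c ≤ 1) (hjfix : ∀ z, ρ z = z ↔ ∃ c, jE c = z)
    (hρρ : ∀ x, ρ (ρ x) = x) (hvρ : ∀ x, Valued.v (ρ x) = Valued.v x) (hα : ρ α ≠ α) (hα1 : Valued.v α ≤ 1)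
    (hintρ : ∀ z : M, Valued.v z ≤ 1 → Valued.v ((z - ρ z) / (α - ρ α)) ≤ 1)
    (hΘΘ : ∀ x, Θ (Θ x) = x) (hΘρ : ∀ x, Θ (ρ x) = ρ (Θ x)) (hvΘ : ∀ x, Valued.v (Θ x) = Valued.v x) (hΘj : ∀ c, Θ (jE c) = jE (σ c))
    (φ : (Fin 2 → E) →+ M) (hφs : ∀ (c : E) (x : Fin 2 → E), φ (c • x) = jE c * φ x)
    {γ₂ : GL (Fin 2) E} {lam hM : M} (hφγ : ∀ x, φ ((γ₂ : Matrix (Fin 2) (Fin 2) E) *ᵥ x) = lam * φ x) (hhM : hM ≠ 0) (hΘh : Θ hM = hM)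
    (hform : ∀ x y, jE (pairing σ H₂ x y) = hM * Θ (φ x) * φ y + ρ (hM * Θ (φ x) * φ y))
    {L : Submodule 𝒪[E] (Fin 3 → E)} {b : ℕ} (hpr : ∀ x ∈ L, Valued.v (x 1) * Valued.v ϖ ^ b ≤ 1)
    (hint : ∀ y ∈ L, Valued.v (pairing σ (!![H₂ 0 0, 0, H₂ 0 1; 0, h, 0; H₂ 1 0, 0, H₂ 1 1] : Matrix (Fin 3) (Fin 3) E) y y) ≤ 1)
    {B₂ : Submodule 𝒪[E] (Fin 2 → E)} {w₀ : Fin 2 → E} {g₀ : Fin 3 → E}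
    (hB : B₂.map ((Matrix.toLin' (!![1, 0; 0, 0; 0, 1] : Matrix (Fin 3) (Fin 2) E)).restrictScalars 𝒪[E]) =
      L ⊓ LinearMap.ker ((LinearMap.proj (1 : Fin 3) : (Fin 3 → E) →ₗ[E] E).restrictScalars 𝒪[E]))
    (hg₀ : g₀ ∈ L) (hg₀1 : Valued.v (g₀ 1) * Valued.v ϖ ^ b = 1) (hprg : g₀ - Pi.single 1 (g₀ 1) = ![w₀ 0, 0, w₀ 1])
    (u : GL (Fin 1) E) (hum : Valued.v ((u : Matrix (Fin 1) (Fin 1) E) 0 0 - 1) ≤ Valued.v (ϖ ^ mstarOfRecord d))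
    {j : ℕ} {x₀ : M} (hx₀ : x₀ ≠ 0) {Λ : AddSubgroup M} (hBΛ : B₂.toAddSubgroup.map φ = Λ)
    (hΛx : ∀ x, x ∈ Λ ↔ ∃ ζ, IsOrd ρ α (jE ϖ ^ j) ζ ∧ x = x₀ * ζ) (hw₀Y : φ w₀ = (dualGen ρ Θ α (jE ϖ ^ j) hM x₀)⁻¹ * x₀)
    -- the cell: integral member of level `b`
    (hYO : IsOrd ρ α (jE ϖ ^ j) (dualGen ρ Θ α (jE ϖ ^ j) hM x₀)) (hYv : Valued.v (dualGen ρ Θ α (jE ϖ ^ j) hM x₀) = Valued.v (jE ϖ) ^ b)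
    -- the coordinates and tokens of the depth multiplier
    {μa μb : E} (hμab : lam - jE ((u : Matrix (Fin 1) (Fin 1) E) 0 0) = jE μa + jE μb * α)
    (hμav : Valued.v μa = Valued.v ϖ ^ (2 * b + d % 2)) {jl : ℕ} (hμbv : Valued.v (jE μb) = Valued.v (jE ϖ) ^ jl)
    -- the clean `E`-letter (★ p862630)
    {f : E} (hσf : σ f = f) (hf1 : Valued.v f = 1) {n : ℕ}
    (hμa : Valued.v (μa + f * ((ϖ - σ ϖ) * ((ϖ * σ ϖ) ^ ((d - d % 2) / 2))⁻¹) * (ϖ * σ ϖ) ^ b) ≤ Valued.v ϖ ^ n)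
    (hn : 2 * b + mstarOfRecord d ≤ n) (hdb : d ≤ b)
    -- the FLIP equation of the cell, above the diagonal
    (hbj : b < j) (hjl : jl = j + b + (2 * (d - 1) + d % 2))
    {c : E} (hσc : σ c = c) (hcu : Valued.v c = 1) (hcN : ¬ ∃ z : E, z * σ z = c) :
    {z : E | ∃ y ∈ L, Valued.v ((ϖ ^ mstarOfRecord d)⁻¹ * (z - pairing σ (!![H₂ 0 0, 0, H₂ 0 1; 0, h, 0; H₂ 1 0, 0, H₂ 1 1] : Matrix (Fin 3) (Fin 3) E) y
        ((((endoGL (γ₂, u) : GL (Fin 3) E) : Matrix (Fin 3) (Fin 3) E) - 1) *ᵥ y))) ≤ 1} =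
      valueSetMod σ ϖ (mstarOfRecord d) ((c * (f * h * ((ϖ ^ b * g₀ 1) * σ (ϖ ^ b * g₀ 1)))) • xPlus σ ϖ d) := by
  obtain ⟨hσσ, hvσ, hϖ, -, hd, hd1, -⟩ := id hD
  have hvϖ0 : Valued.v ϖ ≠ 0 := by rw [hϖ]; exact exp_ne_zero
  have hϖ0 : ϖ ≠ 0 := fun h0 => by rw [h0, map_zero] at hvϖ0; exact hvϖ0 rfl
  have hϖ1 : Valued.v ϖ ≤ 1 := by rw [hϖ, ← exp_zero, exp_le_exp]; norm_num
  have hπ1 : Valued.v (jE ϖ) ≤ 1 := (hjv ϖ).2 hϖ1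
  have hπ0 : Valued.v (jE ϖ) ≠ 0 := (Valuation.ne_zero_iff _).2 ((map_ne_zero jE).2 hϖ0)
  have hπlt : Valued.v (jE ϖ) < 1 := by
    refine lt_of_le_of_ne hπ1 fun h1 => ?_
    have h0 := v_eq_pow_of_map_eq jE hjv hϖ0 (c := ϖ) (n := 0) (by rw [pow_zero, h1])
    rw [pow_zero, hϖ, ← exp_zero] at h0
    exact absurd (exp_injective h0) (by norm_num)
  have hρj : ∀ c : E, ρ (jE c) = jE c := fun c => (hjfix _).2 ⟨c, rfl⟩
  have hα0 : α - ρ α ≠ 0 := sub_ne_zero.2 (Ne.symm hα)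
  obtain ⟨hc, hc0, hc1, hcc⟩ := conductor_letters (ρ := ρ) jE hjfix hα hϖ0 hπ1 j
  have hm : mstarOfRecord d = d % 2 + 2 * d - 1 := rfl
  -- (1) order-integrality at the modulus `m′ := m*`
  have hμaM : Valued.v (jE μa) ≤ Valued.v (jE ϖ) ^ mstarOfRecord d :=
    (v_map_le_pow_iff jE hjv hϖ0 μa _).2 (by rw [hμav]; exact pow_le_pow_right_of_le_one' hϖ1 (by rw [hm]; omega))
  have hμbM : Valued.v (jE μb) ≤ Valued.v (jE ϖ) ^ mstarOfRecord d := by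
    rw [hμbv]; exact pow_le_pow_right_of_le_one' hπ1 (by rw [hm] at *; omega)
  have hμbMj : Valued.v (jE μb) ≤ Valued.v (jE ϖ) ^ (mstarOfRecord d + j) := by
    rw [hμbv]; exact pow_le_pow_right_of_le_one' hπ1 (by rw [hm] at *; omega)
  obtain ⟨μt, hμ, hμt⟩ := exists_isOrd_of_coords (ρ := ρ) jE hρj hα1 hϖ0 hμab hμaM hμbM hμbMj
  -- (2) the glue letters and `hk` above the diagonal (★ `hk_of_lt`)
  have hTr := inv_add_map_inv_eq_map_pairing σ H₂ jE hΘΘ φ hhM hform hcc hx₀ hw₀Y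
  have hw₀g : (![g₀ 0, g₀ 2] : Fin 2 → E) = w₀ := vecTwo_eq_of_sub_single hprg
  have hintg : Valued.v (pairing σ H₂ w₀ w₀ + σ (g₀ 1) * h * g₀ 1) ≤ 1 := by
    have h1 := hint g₀ hg₀
    rwa [pairing_self_eq_plane_add_line σ H₂ h g₀, hw₀g] at h1
  have hu₀ : Valued.v (ϖ ^ b * g₀ 1) = 1 := by rw [Valuation.map_mul, Valuation.map_pow, mul_comm]; exact hg₀1
  have hpw : Valued.v (jE (pairing σ H₂ w₀ w₀)) * Valued.v (jE ϖ) ^ (2 * b) ≤ 1 :=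
    v_map_mul_pow_le_one jE hjv (v_mul_pow_le_one_of_int σ hvσ hϖ1 hintg hu₀ hh1.le)
  have hk := hk_of_lt (ρ := ρ) (α := α) hvΘ jE hπ0 hπlt hα0 (cc := jE ϖ ^ j) (Y := dualGen ρ Θ α (jE ϖ ^ j) hM x₀) rfl hYv
    (by rw [Valuation.map_pow]) hbj hTr hpw
  -- (3) the FLIP DIGIT (★ p862706 `v_boundaryDigit_eq_flip`)
  have hflip := v_boundaryDigit_eq_flip (ρ := ρ) hvΘ hα0 jE hπ0 (cc := jE ϖ ^ j) (Y := dualGen ρ Θ α (jE ϖ ^ j) hM x₀) rfl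
    (by rw [Valuation.map_pow]) hYv hμbv hjl
  exact valueSet_endoGL_sub_one_glued_eq_twist_smul_xPlus_of_flip hD h2v hq H₂ hσh hh1 jE hjv hjfix hρρ hvρ hα hα1 hintρ hΘΘ hΘρ hvΘ hΘj φ hφs hφγ hhM hΘh
    hform hpr hint hB hg₀ hg₀1 hprg u hum hc hc0 hc1 hcc hx₀ hBΛ hΛx hw₀Y hYO hμ hμt le_rfl hμab hσf hf1 hμa hn hdb hk hflip hσc hcu hcN

end Summit.HodgeConjecture.HodgeConjecture.Cruxes.H413.F0P3cDyRamRowVertexLettersOfTokens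

end
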